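/-
Origin: expansion seat `planner-pub-hodgecm-qw8-g11-0`, handover #2 REPLACE (DOC-ONLY) md5 3f631312dc3646d07bfb18f925a2f0a4 (135 l.) SUPERSEDES tree `HodgeCM/Proofs/CupC.lean` 6f058fe3 (121 l.): docstrings added to every undocumented theorem/def (CONVENTIONS §3 debt → 0), comment-stripped code IDENTICAL to the tree copy (residue md5 244a24b9; no declaration, statement or proof changed); imports unchanged (HodgeCM.Geometry.WeightVectors, HodgeCM.Proofs.Prop22.Ba (`HOME/pub-hodgecm-qw8-g11/lean/Qw8g11/CupC.lean`, md5 3f631312, 135 lines);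
landed by the packager successor (mc-unitary-1-g3, gen-8 kit) in gate run 32 REPLACES the earlier landed copy of `HodgeCM/Proofs/CupC.lean` (seat copy carried the packager origin header of the earlier run (stripped)).
-/
/-
Copyright (c) 2026. All rights reserved.
Released under Apache 2.0 license as described in the file LICENSE.
-/
import Summits.HodgeConjecture.HodgeCM.Geometry.WeightVectors
import Summits.HodgeConjecture.HodgeCM.Proofs.Prop22.Basic

/-!
# Degree transport `castCoh`/`castC` and the complexified cup product `cupC` in general bidegree

Shared infrastructure over the `Universe` signature (`HodgeCM.Geometry.Universe`): the identity transport of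
(complexified) cohomology along a degree equality `k = l` (`castCoh`, `castC`; needed because `2p + 2q = 2(p+q)`,
`(i+j)+k = i+(j+k)` are not definitional), its interaction with `pullC`, `trC`, `IsWeightVector`, `algC`, and the
complexification `cupC X i j : H^i(X,ℂ) →ₗ H^j(X,ℂ) →ₗ H^{i+j}(X,ℂ)` of the cup product (`Universe.cup2C` is the
equal-degree case), with `cupC_tmul`, naturality `pullC_cupC` (from M3 `Fact_pull_cup`) and `pullC_mem_algC`
(from M8 `Fact_pull_alg`).  Used by `HodgeCM.StubTree.Qw8Geometric` ([QW8] Thm 2.5 (ii), (iii)+(v)) and offered to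
the Pohlmann seat (`pohl-g2`, `Pohl2.CupC`) so that exactly one copy lands.  Speedrun expansion seat `pub-hodgecm-qw8`,
v4 (split packaging); proposed place `HodgeCM/Geometry/CupC.lean` or `HodgeCM/Proofs/CupC.lean` (it imports
`HodgeCM.Proofs.Prop22.Basic` for `pullC_tmul`/`trC_tmul`) — packager's call.
-/

noncomputable section

open scoped TensorProduct

namespace HodgeCM

open Literature.AlgebraicGeometry.Motives (CMType)

namespace Universe

variable (U : Universe)

/-! ### Degree transport and the general complexified cup product -/

/-- transport of rational classes along a degree equality -/
def castCoh (X : U.Var) {k l : ℕ} (h : k = l) : U.Coh X k ≃ₗ[ℚ] U.Coh X l := by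
  subst h; exact LinearEquiv.refl ℚ _

/-- transport of complexified classes along a degree equality -/
def castC (X : U.Var) {k l : ℕ} (h : k = l) : U.CohC X k ≃ₗ[ℂ] U.CohC X l := by
  subst h; exact LinearEquiv.refl ℂ _

/-- Transport along `rfl : k = k` is the identity. -/
@[simp] theorem castC_rfl (X : U.Var) (k : ℕ) (x : U.CohC X k) : U.castC X (rfl : k = k) x = x := rfl

/-- Transport along any proof of `k = k` is the identity (proof irrelevance). -/
theorem castC_self (X : U.Var) {k : ℕ} (h : k = k) (x : U.CohC X k) : U.castC X h x = x := rfl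

/-- Transports compose: casting along `k = l` and then along `l = m` is casting along `k = m`. -/
theorem castC_castC (X : U.Var) {k l m : ℕ} (h : k = l) (h' : l = m) (x : U.CohC X k) :
    U.castC X h' (U.castC X h x) = U.castC X (h.trans h') x := by subst h; subst h'; rfl

/-- `castC` on a pure tensor `a ⊗ x` is `a ⊗ castCoh x`: the complexified transport is the base
change of the rational one. -/
theorem castC_tmul (X : U.Var) {k l : ℕ} (h : k = l) (a : ℂ) (x : U.Coh X k) :
    U.castC X h (a ⊗ₜ x) = a ⊗ₜ U.castCoh X h x := by subst h; rfl

/-- Degree transport commutes with complexified pull-back `f^*`. -/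
theorem pullC_castC {X Y : U.Var} (f : U.Mor X Y) {k l : ℕ} (h : k = l) (x : U.CohC Y k) :
    U.pullC f l (U.castC Y h x) = U.castC X h (U.pullC f k x) := by subst h; rfl

/-- Degree transport does not change the complexified trace `trC`. -/
theorem trC_castC (X : U.Var) {k l : ℕ} (h : k = l) (x : U.CohC X k) :
    U.trC X l (U.castC X h x) = U.trC X k x := by subst h; rfl

/-- Degree transport preserves the weight-vector property (same CM weight `S` in the transported
degree). -/
theorem isWeightVector_castC (F : CMField) {n : ℕ} (Θ : Fin (n + 1) → CMType F)
    (S : Fin (n + 1) → Finset ((F : Type) →+* ℂ)) {k l : ℕ} (h : k = l) {x : U.CohC (U.cmProd F Θ) k}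
    (hx : U.IsWeightVector F Θ S k x) : U.IsWeightVector F Θ S l (U.castC _ h x) := by
  subst h; exact hx

/-- A transported class is algebraic in codimension `p₂` iff the original class is algebraic in
codimension `p₁` (for `p₁ = p₂`). -/
theorem castC_mem_algC_iff (X : U.Var) {p₁ p₂ : ℕ} (hp : p₁ = p₂) (h : 2 * p₁ = 2 * p₂) (z : U.CohC X (2 * p₁)) :
    U.castC X h z ∈ U.algC X p₂ ↔ z ∈ U.algC X p₁ := by subst hp; exact Iff.rfl

/-- the complexified cup product `H^i(X, ℂ) ⊗ H^j(X, ℂ) → H^{i+j}(X, ℂ)` in all degrees (`cup2C` is the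
case `i = j`) -/
def cupC (X : U.Var) (i j : ℕ) : U.CohC X i →ₗ[ℂ] U.CohC X j →ₗ[ℂ] U.CohC X (i + j) :=
  TensorProduct.curry (((TensorProduct.lift (U.cup X i j)).baseChange ℂ) ∘ₗ
    (TensorProduct.AlgebraTensorModule.distribBaseChange ℚ ℂ (U.Coh X i) (U.Coh X j)).symm.toLinearMap)

/-- The complexified cup product on pure tensors: `(a ⊗ x) ∪ (b ⊗ y) = (ab) ⊗ (x ∪ y)`. -/
@[simp] theorem cupC_tmul (X : U.Var) (i j : ℕ) (a b : ℂ) (x : U.Coh X i) (y : U.Coh X j) :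
    U.cupC X i j (a ⊗ₜ x) (b ⊗ₜ y) = (a * b) ⊗ₜ (U.cup X i j x y) := by
  simp [cupC, TensorProduct.AlgebraTensorModule.distribBaseChange_symm_tmul]

/-- Degree transport in the left factor of `cupC` can be moved to the product. -/
theorem cupC_castC_left (X : U.Var) {i i' j : ℕ} (h : i = i') (x : U.CohC X i) (y : U.CohC X j) :
    U.cupC X i' j (U.castC X h x) y = U.castC X (by rw [h]) (U.cupC X i j x y) := by subst h; rfl

/-- Degree transport in the right factor of `cupC` can be moved to the product. -/
theorem cupC_castC_right (X : U.Var) {i j j' : ℕ} (h : j = j') (x : U.CohC X i) (y : U.CohC X j) :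
    U.cupC X i j' x (U.castC X h y) = U.castC X (by rw [h]) (U.cupC X i j x y) := by subst h; rfl

/-- `f^*(x ∪ y) = f^* x ∪ f^* y` with complex coefficients (from M3 `Fact_pull_cup`). -/
theorem pullC_cupC (hcup : U.Fact_pull_cup) {X Y : U.Var} (f : U.Mor X Y) (i j : ℕ)
    (x : U.CohC Y i) (y : U.CohC Y j) :
    U.pullC f (i + j) (U.cupC Y i j x y) = U.cupC X i j (U.pullC f i x) (U.pullC f j y) := by
  induction x using TensorProduct.induction_on with
  | zero => simp
  | add x x' hx hx' => simp [map_add, LinearMap.add_apply, hx, hx']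
  | tmul a x =>
    induction y using TensorProduct.induction_on with
    | zero => simp
    | add y y' hy hy' => simp [map_add, hy, hy']
    | tmul b y =>
      simp only [pullC, cupC_tmul, LinearMap.baseChange_tmul]
      rw [hcup]

/-- Pull-backs of complexified algebraic classes are algebraic (from M8 `Fact_pull_alg`). -/
theorem pullC_mem_algC (hpa : U.Fact_pull_alg) {X Y : U.Var} (f : U.Mor X Y) (p : ℕ) {x : U.CohC Y (2 * p)}
    (hx : x ∈ U.algC Y p) : U.pullC f (2 * p) x ∈ U.algC X p := by
  unfold algC at hx ⊢
  rw [Submodule.baseChange_eq_span] at hx ⊢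
  induction hx using Submodule.span_induction with
  | mem y hy =>
    obtain ⟨c, hc, rfl⟩ := hy
    refine Submodule.subset_span ⟨U.pull f (2 * p) c, hpa X Y f p ⟨c, hc, rfl⟩, ?_⟩
    simp [pullC, LinearMap.baseChange_tmul]
  | zero => simp
  | add y z _ _ hy hz => rw [map_add]; exact add_mem hy hz
  | smul c y _ hy => rw [map_smul]; exact Submodule.smul_mem _ _ hy

end Universe

end HodgeCM

end
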